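import Mathlib.FieldTheory.RatFunc.AsPolynomial
import Mathlib.Algebra.Polynomial.Roots
import Mathlib.Algebra.Order.Group.Finset
import Mathlib.Algebra.Polynomial.Degree.Domain
import Literature.IUT.HodgeTheaters.KappaCoricFunctions
import HarnessLib

/-!
# [IUTchI] Remark 3.1.7 (i), (ii): the elementary claims about `κ`-coric functions — PROOFS

S. Mochizuki, *Inter-universal Teichmüller theory I*, §3, Remark 3.1.7 (i), (ii) (kurims final
manuscript May 2020, p. 67) [claim: Mochizuki2012, status: disputed]. PROOF-ONLY companion of
`Literature/IUT/HodgeTheaters/KappaCoricFunctions.lean` (statement module, abc-iut-L5-t2): no new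
definitions; we discharge three of the five printed claims typed there as `Prop`s, for EVERY field
`Ω` of characteristic zero and every `CriticalLocus`:

* `CriticalLocus.notBothKappaCoric_holds` — "whenever `f ∉ L`, it is never the case that both `f` and
  `f⁻¹` are `κ`-coric" (the poles of `f⁻¹` are the zeroes of `f`, of which there are at least two);
* `CriticalLocus.kappaCoricIffInfty_holds` — "`f` is `κ`-coric if and only if it is `∞κ`-coric"
  (`fⁿ` and `f` have the same zero/pole sets, and `fⁿ(e) = f(e)ⁿ`);
* `CriticalLocus.inftyKappaUnitCoricCriterion_holds` — "an `∞κ×`-coric `f` is `∞κ`-coric if and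
  only if it restricts to a root of unity at some [or, equivalently, every] strictly critical point"
  (if `(c·f)ⁿ` is `κ`-coric and `f(e₀)` is a root of unity then so is `c`, say `c^N = 1`, and then
  `f^{nN} = ((c·f)ⁿ)^N` is `κ`-coric).

The tools are elementary facts about Mathlib's normalised numerator/denominator `RatFunc.num`,
`RatFunc.denom` (`num (fⁿ) = (num f)ⁿ`, `num (C k * f) = C k * num f` for `k ≠ 0`, roots of
associated polynomials) which Mathlib does not state in this form. The two EXISTENCE claims of
(ii) (a `κ`-coric `f_sol` of degree `4`; every value is attained) are discharged, under the standing
hypotheses of the Remark (strictly critical points algebraic over `ℚ`, `Ω = L̄` algebraically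
closed), in `KappaCoricFunctionsExistence.lean`. Nothing here bears on the disputed parts of the
series; typed claims are kernel-checked consequences of the typed definitions only.
-/

namespace Literature.IUT.HodgeTheaters

open Polynomial
open scoped RatFunc Classical

universe u

variable {Ω : Type u} [Field Ω]

namespace CriticalLocus

/-! ### Numerator and denominator of powers, constant multiples and inverses -/

/-- Uniqueness of the normalised numerator/denominator: if `q` is monic and coprime to `p`, then
`p / q` has numerator `p` and denominator `q`. [folklore] -/
private theorem num_denom_div_of_isCoprime {p q : Ω[X]} (hq : q.Monic) (hpq : IsCoprime p q) :
    (algebraMap Ω[X] (RatFunc Ω) p / algebraMap Ω[X] (RatFunc Ω) q).num = p ∧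
      (algebraMap Ω[X] (RatFunc Ω) p / algebraMap Ω[X] (RatFunc Ω) q).denom = q := by
  set x := algebraMap Ω[X] (RatFunc Ω) p / algebraMap Ω[X] (RatFunc Ω) q with hx
  have h : x.num * q = p * x.denom := (RatFunc.num_mul_eq_mul_denom_iff hq.ne_zero).mpr rfl
  have h1 : q ∣ x.denom := by
    refine (hpq.symm).dvd_of_dvd_mul_left ⟨x.num, ?_⟩
    rw [← h, mul_comm]
  have h2 : x.denom ∣ q := by
    refine (RatFunc.isCoprime_num_denom x).symm.dvd_of_dvd_mul_left ⟨p, ?_⟩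
    rw [h, mul_comm]
  have hd : x.denom = q :=
    (Polynomial.eq_of_monic_of_associated (RatFunc.monic_denom x) hq
      (associated_of_dvd_dvd h2 h1))
  refine ⟨?_, hd⟩
  rw [hd] at h
  exact mul_right_cancel₀ hq.ne_zero h

/-- `num (fⁿ) = (num f)ⁿ` and `denom (fⁿ) = (denom f)ⁿ`. [folklore] -/
private theorem num_denom_pow (f : RatFunc Ω) (n : ℕ) :
    (f ^ n).num = f.num ^ n ∧ (f ^ n).denom = f.denom ^ n := by
  have key := num_denom_div_of_isCoprime ((RatFunc.monic_denom f).pow n)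
    ((RatFunc.isCoprime_num_denom f).pow (m := n) (n := n))
  have hf : f ^ n = algebraMap Ω[X] (RatFunc Ω) (f.num ^ n) /
      algebraMap Ω[X] (RatFunc Ω) (f.denom ^ n) := by
    rw [map_pow, map_pow, ← div_pow, RatFunc.num_div_denom]
  rw [hf]; exact key

/-- `num (C k · f) = C k · num f` and `denom (C k · f) = denom f` for a nonzero constant `k`.
[folklore] -/
private theorem num_denom_C_mul (f : RatFunc Ω) {k : Ω} (hk : k ≠ 0) :
    (RatFunc.C k * f).num = Polynomial.C k * f.num ∧ (RatFunc.C k * f).denom = f.denom := by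
  have hunit : IsUnit (Polynomial.C k) := Polynomial.isUnit_C.mpr (isUnit_iff_ne_zero.mpr hk)
  have key := num_denom_div_of_isCoprime (RatFunc.monic_denom f)
    ((isCoprime_mul_unit_left_left hunit f.num f.denom).mpr (RatFunc.isCoprime_num_denom f))
  have hf : RatFunc.C k * f = algebraMap Ω[X] (RatFunc Ω) (Polynomial.C k * f.num) /
      algebraMap Ω[X] (RatFunc Ω) f.denom := by
    rw [map_mul, RatFunc.algebraMap_C, mul_div_assoc, RatFunc.num_div_denom]
  rw [hf]; exact key

/-- Associated polynomials over a field have the same roots. [folklore] -/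
private theorem roots_eq_of_associated {p q : Ω[X]} (h : Associated p q) : p.roots = q.roots := by
  obtain ⟨u, hu⟩ := h
  obtain ⟨r, hr, hru⟩ := Polynomial.isUnit_iff.mp u.isUnit
  rw [← hu, ← hru, mul_comm, Polynomial.roots_C_mul _ hr.ne_zero]

/-- Zeroes and poles of a power: `zeroes (fⁿ) = zeroes f`, `poles (fⁿ) = poles f` (`n ≠ 0`).
[folklore] -/
private theorem zeroes_poles_pow (f : RatFunc Ω) {n : ℕ} (hn : n ≠ 0) :
    zeroes (f ^ n) = zeroes f ∧ poles (f ^ n) = poles f := by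
  obtain ⟨hnum, hden⟩ := num_denom_pow f n
  refine ⟨?_, ?_⟩
  · simp only [zeroes, hnum, Polynomial.roots_pow, Multiset.toFinset_nsmul _ _ hn]
  · simp only [poles, hden, Polynomial.roots_pow, Multiset.toFinset_nsmul _ _ hn]

/-- Zeroes and poles of a nonzero constant multiple. [folklore] -/
private theorem zeroes_poles_C_mul (f : RatFunc Ω) {k : Ω} (hk : k ≠ 0) :
    zeroes (RatFunc.C k * f) = zeroes f ∧ poles (RatFunc.C k * f) = poles f := by
  obtain ⟨hnum, hden⟩ := num_denom_C_mul f hk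
  refine ⟨?_, ?_⟩
  · simp only [zeroes, hnum, Polynomial.roots_C_mul _ hk]
  · simp only [poles, hden]

/-- Evaluation of a power: `fⁿ(a) = f(a)ⁿ` (no side condition, thanks to the normal form).
[folklore] -/
private theorem eval_pow' (f : RatFunc Ω) (n : ℕ) (a : Ω) :
    (f ^ n).eval (RingHom.id Ω) a = (f.eval (RingHom.id Ω) a) ^ n := by
  obtain ⟨hnum, hden⟩ := num_denom_pow f n
  simp only [RatFunc.eval, hnum, hden, Polynomial.eval₂_id, Polynomial.eval_pow, div_pow]

/-- Evaluation of a constant multiple: `(k·f)(a) = k · f(a)` for `k ≠ 0`. [folklore] -/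
private theorem eval_C_mul' (f : RatFunc Ω) {k : Ω} (hk : k ≠ 0) (a : Ω) :
    (RatFunc.C k * f).eval (RingHom.id Ω) a = k * f.eval (RingHom.id Ω) a := by
  obtain ⟨hnum, hden⟩ := num_denom_C_mul f hk
  simp only [RatFunc.eval, hnum, hden, Polynomial.eval₂_id, Polynomial.eval_mul, Polynomial.eval_C,
    mul_div_assoc]

/-- A power of a non-constant rational function is non-constant. [folklore] -/
private theorem pow_ne_C_of_ne_C {f : RatFunc Ω} (hf : ∀ c : Ω, f ≠ RatFunc.C c) {n : ℕ}
    (hn : n ≠ 0) : ∀ c : Ω, f ^ n ≠ RatFunc.C c := by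
  intro c hc
  obtain ⟨hnum, hden⟩ := num_denom_pow f n
  have h1 : (f.num ^ n).natDegree = 0 := by rw [← hnum, hc, RatFunc.num_C, Polynomial.natDegree_C]
  have h2 : (f.denom ^ n).natDegree = 0 := by
    rw [← hden, hc, RatFunc.denom_C, Polynomial.natDegree_one]
  rw [Polynomial.natDegree_pow, mul_eq_zero] at h1 h2
  obtain ⟨c', hc'⟩ := (RatFunc.eq_C_iff f).mpr ⟨h1.resolve_left hn, h2.resolve_left hn⟩
  exact hf c' hc'

/-- A function with a non-constant power is non-constant. [folklore] -/
private theorem ne_C_of_pow_ne_C {f : RatFunc Ω} {n : ℕ} (hf : ∀ c : Ω, f ^ n ≠ RatFunc.C c) :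
    ∀ c : Ω, f ≠ RatFunc.C c := by
  intro c hc
  exact hf (c ^ n) (by rw [hc, map_pow])

/-! ### `κ`-coricity of powers -/

section Claims

variable [CharZero Ω] (S : CriticalLocus Ω)

/-- A `κ`-coric function takes a NONZERO value at every strictly critical point (no zero, no pole
there). [claim: Mochizuki2012, status: disputed] -/
theorem IsKappaCoric.eval_ne_zero {f : RatFunc Ω} (hf : S.IsKappaCoric f) {e : Ω} (he : e ∈ S.pts) :
    f.eval (RingHom.id Ω) e ≠ 0 := by
  simp only [RatFunc.eval, Polynomial.eval₂_id]
  exact div_ne_zero (hf.avoids.num_eval_ne e he) (hf.avoids.denom_eval_ne e he)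

/-- A `κ`-coric function is nonzero (a strictly critical point exists and `f` does not vanish there).
[claim: Mochizuki2012, status: disputed] -/
theorem IsKappaCoric.ne_zero {f : RatFunc Ω} (hf : S.IsKappaCoric f) : f ≠ 0 := by
  obtain ⟨e, he⟩ : S.pts.Nonempty := by rw [← Finset.card_pos, S.card_eq]; norm_num
  intro h
  apply hf.avoids.num_eval_ne e he
  rw [h, RatFunc.num_zero, Polynomial.eval_zero]

/-- Powers of `κ`-coric functions are `κ`-coric (Rmk 3.1.7 (ii): "`κ`-coric ⇒ `∞κ`-coric" is the
case used in print; we need all `n ≥ 1`). [claim: Mochizuki2012, status: disputed] -/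
theorem IsKappaCoric.pow {f : RatFunc Ω} (hf : S.IsKappaCoric f) {n : ℕ} (hn : 0 < n) :
    S.IsKappaCoric (f ^ n) := by
  obtain ⟨hz, hp⟩ := zeroes_poles_pow f hn.ne'
  obtain ⟨hnum, hden⟩ := num_denom_pow f n
  refine ⟨fun hc => ?_, fun z hz' => ?_, ⟨fun e he => ?_, fun e he => ?_, ?_⟩, fun e he => ?_⟩
  · rw [hz, hp]; exact hf.one_pole_two_zeroes (ne_C_of_pow_ne_C hc)
  · rw [hz, hp] at hz'; exact hf.divisor_algebraic z hz'
  · rw [hnum, Polynomial.eval_pow]; exact pow_ne_zero _ (hf.avoids.num_eval_ne e he)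
  · rw [hden, Polynomial.eval_pow]; exact pow_ne_zero _ (hf.avoids.denom_eval_ne e he)
  · rw [hnum, hden, Polynomial.natDegree_pow, Polynomial.natDegree_pow, hf.avoids.natDegree_eq]
  · obtain ⟨m, hm, hme⟩ := hf.rootOfUnity_at_critical e he
    exact ⟨m, hm, by rw [eval_pow', ← pow_mul, mul_comm, pow_mul, hme, one_pow]⟩

/-- Conversely, if some positive power `fⁿ` is `κ`-coric then `f` is `κ`-coric (Rmk 3.1.7 (ii):
"`∞κ`-coric ⇒ `κ`-coric"). [claim: Mochizuki2012, status: disputed] -/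
theorem IsKappaCoric.of_pow {f : RatFunc Ω} {n : ℕ} (hn : 0 < n) (hf : S.IsKappaCoric (f ^ n)) :
    S.IsKappaCoric f := by
  obtain ⟨hz, hp⟩ := zeroes_poles_pow f hn.ne'
  obtain ⟨hnum, hden⟩ := num_denom_pow f n
  refine ⟨fun hc => ?_, fun z hz' => ?_, ⟨fun e he => ?_, fun e he => ?_, ?_⟩, fun e he => ?_⟩
  · rw [← hz, ← hp]; exact hf.one_pole_two_zeroes (pow_ne_C_of_ne_C hc hn.ne')
  · rw [← hz, ← hp] at hz'; exact hf.divisor_algebraic z hz'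
  · have := hf.avoids.num_eval_ne e he
    rw [hnum, Polynomial.eval_pow] at this; exact (pow_ne_zero_iff hn.ne').mp this
  · have := hf.avoids.denom_eval_ne e he
    rw [hden, Polynomial.eval_pow] at this; exact (pow_ne_zero_iff hn.ne').mp this
  · have := hf.avoids.natDegree_eq
    rw [hnum, hden, Polynomial.natDegree_pow, Polynomial.natDegree_pow] at this
    exact Nat.eq_of_mul_eq_mul_left hn this
  · obtain ⟨m, hm, hme⟩ := hf.rootOfUnity_at_critical e he
    exact ⟨n * m, Nat.mul_pos hn hm, by rw [pow_mul, ← eval_pow', hme]⟩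

/-! ### The three printed claims -/

/-- **Rmk 3.1.7 (i), p. 67, DISCHARGED**: "whenever `f ∉ L`, it is never the case that both `f` and
`f⁻¹` are `κ`-coric" — the poles of `f⁻¹` are the (at least two) zeroes of `f`, contradicting
"precisely one pole". [claim: Mochizuki2012, status: disputed] -/
theorem notBothKappaCoric_holds (f : RatFunc Ω) : S.NotBothKappaCoric f := by
  rintro hnc ⟨hf, hfi⟩
  have hf0 : f ≠ 0 := hf.ne_zero
  -- `f⁻¹` is non-constant as well
  have hnci : ∀ c : Ω, f⁻¹ ≠ RatFunc.C c := by
    intro c hc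
    exact hnc c⁻¹ (by rw [← inv_inv f, hc, map_inv₀])
  obtain ⟨hpoles_inv, -⟩ := hfi.one_pole_two_zeroes hnci
  obtain ⟨-, hzeroes⟩ := hf.one_pole_two_zeroes hnc
  -- poles of `f⁻¹` = zeroes of `f`
  have hpz : poles f⁻¹ = zeroes f := by
    simp only [poles, zeroes, roots_eq_of_associated (RatFunc.associated_denom_inv hf0)]
  rw [hpz] at hpoles_inv
  omega

/-- **Rmk 3.1.7 (ii), p. 67, DISCHARGED**: "an element `f ∈ L_C` is `κ`-coric if and only if it is
`∞κ`-coric". [claim: Mochizuki2012, status: disputed] -/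
theorem kappaCoricIffInfty_holds (f : RatFunc Ω) : S.KappaCoricIffInfty f := by
  refine ⟨fun hf => ⟨1, Nat.one_pos, by rwa [pow_one]⟩, ?_⟩
  rintro ⟨n, hn, hfn⟩
  exact IsKappaCoric.of_pow S hn hfn

/-- **Rmk 3.1.7 (ii), p. 67, DISCHARGED**: "an `∞κ×`-coric element `f ∈ L_C` is `∞κ`-coric if and
only if it restricts to a root of unity at some [or, equivalently, every] strictly critical point"
(both readings; valid for every parameter set `U`). [claim: Mochizuki2012, status: disputed] -/
theorem inftyKappaUnitCoricCriterion_holds (U : Set Ω) (f : RatFunc Ω) :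
    S.InftyKappaUnitCoricCriterion U f := by
  rintro ⟨c, -, n, hn, hcf⟩
  have hne : S.pts.Nonempty := by rw [← Finset.card_pos, S.card_eq]; norm_num
  -- `c ≠ 0`, since `(c·f)ⁿ` is `κ`-coric, hence nonzero
  have hc : c ≠ 0 := by
    rintro rfl
    exact (hcf.ne_zero S) (by rw [map_zero, zero_mul, zero_pow hn.ne'])
  -- forward direction: powers evaluate to powers
  have fwd : S.IsInftyKappaCoric f → ∀ e ∈ S.pts, ∃ m : ℕ, 0 < m ∧ (f.eval (RingHom.id Ω) e) ^ m = 1 := by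
    rintro ⟨m, hm, hfm⟩ e he
    obtain ⟨k, hk, hke⟩ := hfm.rootOfUnity_at_critical e he
    exact ⟨m * k, Nat.mul_pos hm hk, by rw [pow_mul, ← eval_pow', hke]⟩
  -- backward direction from a single strictly critical point
  have bwd : ∀ e ∈ S.pts, (∃ m : ℕ, 0 < m ∧ (f.eval (RingHom.id Ω) e) ^ m = 1) →
      S.IsInftyKappaCoric f := by
    rintro e he ⟨m, hm, hfe⟩
    obtain ⟨k, hk, hke⟩ := hcf.rootOfUnity_at_critical e he
    rw [eval_pow', eval_C_mul' f hc, ← pow_mul, mul_pow] at hke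
    -- `c` is a root of unity: `c ^ (n*k*m) = 1`
    have hcroot : c ^ (n * k * m) = 1 := by
      calc c ^ (n * k * m)
          = c ^ (n * k * m) * ((f.eval (RingHom.id Ω) e) ^ m) ^ (n * k) := by
            rw [hfe, one_pow, mul_one]
        _ = (c ^ (n * k) * f.eval (RingHom.id Ω) e ^ (n * k)) ^ m := by ring
        _ = 1 := by rw [hke, one_pow]
    -- hence `f ^ (n * (n*k*m)) = ((c f)ⁿ)^(n k m)` is `κ`-coric
    refine ⟨n * (n * k * m), Nat.mul_pos hn (Nat.mul_pos (Nat.mul_pos hn hk) hm), ?_⟩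
    have key := hcf.pow S (Nat.mul_pos (Nat.mul_pos hn hk) hm)
    have hpow : ((RatFunc.C c * f) ^ n) ^ (n * k * m) = f ^ (n * (n * k * m)) := by
      calc ((RatFunc.C c * f) ^ n) ^ (n * k * m)
          = RatFunc.C (c ^ (n * (n * k * m))) * f ^ (n * (n * k * m)) := by
            rw [← pow_mul, mul_pow, map_pow]
        _ = f ^ (n * (n * k * m)) := by
            rw [show c ^ (n * (n * k * m)) = 1 by rw [mul_comm n, pow_mul, hcroot, one_pow],
              map_one, one_mul]
    rwa [hpow] at key
  obtain ⟨e₀, he₀⟩ := hne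
  exact ⟨⟨fun h => ⟨e₀, he₀, fwd h e₀ he₀⟩, fun ⟨e, he, hm⟩ => bwd e he hm⟩,
    ⟨fwd, fun h => bwd e₀ he₀ (h e₀ he₀)⟩⟩

end Claims

end CriticalLocus

end Literature.IUT.HodgeTheaters
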